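import Summits.Ventures.PercRepro.C026ProdCFMulti

/-!
# THEOREM PROD-CF, Corollary 3 verbatim: C-026 at `p = ½` is component-wise (p5, gen 16)

mine-3's Corollary 3 (`proofs/MINE3-PRODUCT.md` §2b): «if every one-component core `H_Γ` (`Γ` a
component of `G − {a, b, c}`, with its attachment edges) satisfies C-026 at `p = ½`, then so does
`G`». The components are the classes of `OffMarks` — joined by a walk through non-marks — and the
**component colouring** `compColour` gives an edge at a non-mark the class of that end and a
mark–mark edge (or loop at a mark) its own colour; it is a multi-gluing (`isGluingMulti_compColour`),
its classes are the cores `H_Γ` (`colClassGraph _ (Sum.inl κ)`) and the single mark–mark edges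
(`colClassGraph _ (Sum.inr e)`), and a single-edge graph satisfies (CF) trivially
(`nTwo_false_of_subsingleton`: `N² = ∅`). So `slackCF_nonneg_of_colouring_aux` gives

  **`slackCF_nonneg_of_components`**: `0 ≤ Δ_CF(H_Γ)` for every component `Γ` carrying an edge
  implies `0 ≤ Δ_CF(G)`.
-/

namespace PercRepro

open Finset

namespace MultiGraph

section Components

variable {V E : Type*} (G : MultiGraph V E)

/-- `x` and `y` are joined by a walk of `G` through non-marks only (every edge counted open). -/
def OffMarks (a b c : V) (x y : V) : Prop :=
  G.ConnAvoid (fun _ => true) ({a, b, c} : Set V) x y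

/-- `OffMarks` is an equivalence relation: its classes are the components of `G − {a, b, c}` (the
marks and the isolated vertices are singleton classes). -/
def offMarksSetoid (a b c : V) : Setoid V :=
  ⟨G.OffMarks a b c, ⟨fun _ => Relation.ReflTransGen.refl, fun h => h.symm,
    fun h₁ h₂ => Relation.ReflTransGen.trans h₁ h₂⟩⟩

open Classical in
/-- **The component colouring**: an edge at a non-mark gets the component of that end, a mark–mark
edge (or a loop at a mark) gets itself. -/
noncomputable def compColour (a b c : V) (e : E) : Quotient (G.offMarksSetoid a b c) ⊕ E :=
  if G.fst e ∉ ({a, b, c} : Set V) then Sum.inl ⟦G.fst e⟧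
  else if G.snd e ∉ ({a, b, c} : Set V) then Sum.inl ⟦G.snd e⟧ else Sum.inr e

variable {G}

/-- An edge at a non-mark `v` has the colour of `v`'s component. -/
theorem compColour_of_edgeAt {a b c v : V} (hv : v ∉ ({a, b, c} : Set V)) {e : E}
    (he : G.EdgeAt e v) :
    G.compColour a b c e = Sum.inl (⟦v⟧ : Quotient (G.offMarksSetoid a b c)) := by
  classical
  unfold compColour
  rcases he with h | h
  · rw [h, if_pos hv]
  · by_cases hf : G.fst e ∉ ({a, b, c} : Set V)
    · rw [if_pos hf]
      congr 1
      refine Quotient.sound ?_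
      show G.OffMarks a b c (G.fst e) v
      exact Relation.ReflTransGen.single ⟨⟨e, rfl, Or.inl ⟨rfl, h⟩⟩, hf, hv⟩
    · rw [if_neg hf, h, if_pos hv]

/-- **The component colouring is a multi-gluing**: every non-mark carries edges of one colour. -/
theorem isGluingMulti_compColour (a b c : V) :
    G.IsGluingMulti a b c (G.compColour a b c) := by
  intro v hva hvb hvc e e' he he'
  have hv : v ∉ ({a, b, c} : Set V) := by
    simp only [Set.mem_insert_iff, Set.mem_singleton_iff, not_or]
    exact ⟨hva, hvb, hvc⟩
  rw [compColour_of_edgeAt hv he, compColour_of_edgeAt hv he']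

/-- The colour class of a mark–mark edge `e` consists of `e` alone. -/
instance subsingleton_compColour_inr (a b c : V) (e : E) :
    Subsingleton {e' : E // G.compColour a b c e' = Sum.inr e} := by
  classical
  refine ⟨fun x y => Subtype.ext ?_⟩
  have hx := x.2
  have hy := y.2
  unfold compColour at hx hy
  split_ifs at hx hy
  exact (Sum.inr.inj hx).trans (Sum.inr.inj hy).symm

/-- **A graph with at most one edge has `N² = ∅`**: an open `a`–`b` walk there is a single edge
from `a` to `b`, which avoids the closed cluster of `c` once `a, b` do. -/
theorem nTwo_false_of_subsingleton {E' : Type*} [Subsingleton E'] (H : MultiGraph V E')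
    (ω : Config E') (a b c : V) : ¬ H.NTwo ω a b c := by
  rintro ⟨hab, hca, hcb, hav⟩
  apply hav
  have key : ∀ y, H.Conn ω a y → y = a ∨ H.OpenAdj ω a y := by
    intro y hy
    refine Conn.induction (motive := fun y => y = a ∨ H.OpenAdj ω a y) (Or.inl rfl) ?_ hy
    intro x y _ hxy hx
    rcases hx with rfl | hx
    · exact Or.inr hxy
    · obtain ⟨e₁, he₁, hend₁⟩ := hx
      obtain ⟨e₂, he₂, hend₂⟩ := hxy
      have he : e₂ = e₁ := Subsingleton.elim _ _
      subst he
      rcases hend₁ with ⟨h1, h2⟩ | ⟨h1, h2⟩ <;> rcases hend₂ with ⟨h3, h4⟩ | ⟨h3, h4⟩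
      · exact Or.inl (h4.symm.trans (h2.trans (h3.symm.trans h1)))
      · exact Or.inl (h3.symm.trans h1)
      · exact Or.inl (h4.symm.trans h2)
      · exact Or.inr ⟨e₂, he₁, Or.inr ⟨h3, h2⟩⟩
  rcases key b hab with rfl | hadj
  · exact Relation.ReflTransGen.refl
  · exact Relation.ReflTransGen.single ⟨hadj, hca, hcb⟩

open Classical in
/-- A graph with at most one edge satisfies (CF). -/
theorem slackCF_nonneg_of_subsingleton {E' : Type*} [Fintype E'] [Subsingleton E']
    (H : MultiGraph V E') (a b c : V) : 0 ≤ H.slackCF a b c := by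
  rw [slackCF_eq]
  have h0 : (univ.filter fun ω : Config E' => H.NTwo ω a b c) = ∅ :=
    Finset.filter_eq_empty_iff.mpr fun ω _ => nTwo_false_of_subsingleton H ω a b c
  rw [h0, Finset.card_empty, Nat.cast_zero, sub_zero]
  positivity

open Classical in
/-- **COROLLARY 3 (mine-3, PROD-CF): C-026 at `p = ½` is component-wise.** If every component `Γ`
of `G − {a, b, c}` carrying an edge has `0 ≤ Δ_CF` on its core `H_Γ = Γ ∪ {a, b, c}` with the
attachment edges (the colour class `Sum.inl κ` of the component colouring), then `0 ≤ Δ_CF(G)`: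
the mark–mark edges and loops are single-edge classes, which satisfy (CF) trivially, and the
multi-gluing theorem composes. -/
theorem slackCF_nonneg_of_components [Fintype E] (a b c : V)
    (h : ∀ κ : Quotient (G.offMarksSetoid a b c), (∃ e, G.compColour a b c e = Sum.inl κ) →
      0 ≤ (G.colClassGraph (G.compColour a b c) (Sum.inl κ)).slackCF a b c) :
    0 ≤ G.slackCF a b c := by
  refine slackCF_nonneg_of_colouring_aux a b c (univ.image (G.compColour a b c)) G
    (G.compColour a b c) (isGluingMulti_compColour a b c)
    (fun e => Finset.mem_image_of_mem _ (Finset.mem_univ e)) fun i hi => ?_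
  rcases i with κ | e
  · obtain ⟨e, _, he⟩ := Finset.mem_image.mp hi
    exact h κ ⟨e, he⟩
  · exact slackCF_nonneg_of_subsingleton _ a b c

end Components

end MultiGraph

end PercRepro
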